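import Summits.RiemannHypothesis.RiemannHypothesis.Theorems.PfPersistenceNearLagLadder
import HarnessLib

/-!
# PF-persistence cell — THE LADDER CONSTANT IS SHARP: the discrete step of the near-lag ceiling is an equality

Framing (page 1): mechanism/rigidity campaign; no RH claims.  Every `theorem` below is PROVED (kernel-checked,
RH-free, weight-free, window-free: pure trigonometry); nothing here is a statement about `ζ`.

The complete near-lag ladder (`PfPersistenceNearLagLadder`, 186f1e2d346c) bounds the odd autocorrelation of a
one-signed odd profile at lags `y ≥ L/(2m)` by `c_m‖v‖²`, `c_m = cos(π/(m+1))`, through ONE discrete step: the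
`m`-piece chain inequality with the sine-chain weights `ρ_k = sin((k+1)θ)`, `θ = π/(m+1)` (there `m = n + 2`).  This
file isolates that step as the PATH-GRAPH RAYLEIGH BOUND and proves it is an EQUALITY at the sine vector:
* §1 `2·Σ_{k≤n} x_k x_{k+1} ≤ 2cos(π/(n+3))·Σ_{k≤n+1} x_k²` for all real `x_0, …, x_{n+1}` (AM–GM with the chain
  ratios, inlined, + `chain_sum_eq`) — the largest adjacency eigenvalue of the path on `n+2` vertices is at most `2cos(π/(n+3))`;
* §2 equality at `x_k = sin((k+1)π/(n+3))` (the chain identity `sin_chain` summed, end terms vanishing by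
  `sin 0 = 0` and `sin_chain_end`), and this vector is nonzero — so `2cos(π/(n+3))` IS the maximum
  [cite: Mieghem2010, §6.4.1 eq. (6.10)], now a Lean theorem rather than a citation.
CONSEQUENCE FOR THE CELL (words, not a theorem about profiles): no re-weighting of the `m`-piece chain lowers
`c_m`; an improvement of the near-lag ceiling at fixed block size `N` would need an input the chain does not see
(the profile is an odd trigonometric polynomial of degree `≤ N`, not an arbitrary one-signed function) — OPEN, and
not claimed.  Nothing here bears on RH.
-/

set_option linter.dupNamespace false
set_option linter.style.longLine false

open Real Finset

noncomputable section

namespace Summit.RiemannHypothesis.RiemannHypothesis.Theorems.PfPersistence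

/-! ## §1 The path-graph Rayleigh bound -/

/-- **PROVED — THE PATH-GRAPH RAYLEIGH BOUND** (the discrete step of the near-lag ladder): for all real
`x_0, …, x_{n+1}`, `2·Σ_{k≤n} x_k x_{k+1} ≤ 2cos(π/(n+3))·Σ_{k≤n+1} x_k²`. [cite: Mieghem2010, §6.4.1 eq. (6.10)] -/
theorem two_mul_sum_mul_succ_le_cos (n : ℕ) (x : ℕ → ℝ) :
    2 * ∑ k ∈ Finset.range (n + 1), x k * x (k + 1)
      ≤ 2 * Real.cos (π / ((n:ℝ) + 3)) * ∑ k ∈ Finset.range (n + 2), x k ^ 2 := by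
  have hchain := chain_sum_eq n (fun k => x k ^ 2)
  rw [← hchain]
  conv_lhs => rw [Finset.mul_sum]
  refine Finset.sum_le_sum fun k hk => ?_
  have hk' : k ≤ n := Nat.lt_succ_iff.mp (Finset.mem_range.mp hk)
  have h1 : 0 < Real.sin (((k:ℝ) + 1) * (π / ((n:ℝ) + 3))) := sin_chain_pos (n := n) (k := k) (by omega)
  have h2 : 0 < Real.sin (((k:ℝ) + 1 + 1) * (π / ((n:ℝ) + 3))) := by
    have := sin_chain_pos (n := n) (k := k + 1) (by omega); push_cast at this; exact this
  set r := Real.sin (((k:ℝ) + 1 + 1) * (π / ((n:ℝ) + 3))) / Real.sin (((k:ℝ) + 1) * (π / ((n:ℝ) + 3))) with hr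
  have hr0 : 0 < r := div_pos h2 h1
  have hinv : Real.sin (((k:ℝ) + 1) * (π / ((n:ℝ) + 3))) / Real.sin (((k:ℝ) + 1 + 1) * (π / ((n:ℝ) + 3))) = 1 / r := by
    rw [hr, one_div_div]
  rw [hinv]
  -- AM–GM with the positive ratio `r` (cf. `Literature…Montgomery.two_mul_le_mul_sq_add_sq_div`): `2ab ≤ r a² + b²/r`
  have hamgm : 2 * x k * x (k + 1) ≤ r * x k ^ 2 + x (k + 1) ^ 2 / r := by
    have h : 0 ≤ (r * x k - x (k + 1)) ^ 2 / r := div_nonneg (sq_nonneg _) hr0.le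
    have e : (r * x k - x (k + 1)) ^ 2 / r = r * x k ^ 2 + x (k + 1) ^ 2 / r - 2 * x k * x (k + 1) := by
      field_simp
      ring
    linarith [h, e]
  calc 2 * (x k * x (k + 1)) = 2 * x k * x (k + 1) := by ring
    _ ≤ r * x k ^ 2 + x (k + 1) ^ 2 / r := hamgm
    _ = r * x k ^ 2 + 1 / r * x (k + 1) ^ 2 := by ring

/-! ## §2 Equality at the sine vector -/

/-- **PROVED — THE CHAIN IS TIGHT:** at `x_k = sin((k+1)π/(n+3))` the path-graph Rayleigh bound is an equality,
`2·Σ_{k≤n} x_k x_{k+1} = 2cos(π/(n+3))·Σ_{k≤n+1} x_k²` (the sine vector is the Perron eigenvector of the path on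
`n+2` vertices). [cite: Mieghem2010, §6.4.1 eq. (6.10)] -/
theorem chain_tight (n : ℕ) :
    2 * ∑ k ∈ Finset.range (n + 1),
        Real.sin (((k:ℝ) + 1) * (π / ((n:ℝ) + 3))) * Real.sin (((k:ℝ) + 2) * (π / ((n:ℝ) + 3)))
      = 2 * Real.cos (π / ((n:ℝ) + 3))
        * ∑ k ∈ Finset.range (n + 2), Real.sin (((k:ℝ) + 1) * (π / ((n:ℝ) + 3))) ^ 2 := by
  set θ := π / ((n:ℝ) + 3) with hθ
  -- pointwise chain identity: 2cos θ · x_k = x_{k+1} + x_{k-1}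
  have hpt : ∀ k : ℕ, 2 * Real.cos θ * Real.sin (((k:ℝ) + 1) * θ) ^ 2
      = Real.sin (((k:ℝ) + 2) * θ) * Real.sin (((k:ℝ) + 1) * θ)
        + Real.sin ((k:ℝ) * θ) * Real.sin (((k:ℝ) + 1) * θ) := by
    intro k
    have hc := sin_chain (k:ℝ) θ
    rw [sq, ← mul_assoc, ← add_mul, hc]
  conv_rhs => rw [Finset.mul_sum]
  simp_rw [hpt]
  rw [Finset.sum_add_distrib]
  -- first sum: the last term vanishes (`sin ((n+3)θ) = 0`)
  have hA : ∑ k ∈ Finset.range (n + 2), Real.sin (((k:ℝ) + 2) * θ) * Real.sin (((k:ℝ) + 1) * θ)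
      = ∑ k ∈ Finset.range (n + 1), Real.sin (((k:ℝ) + 1) * θ) * Real.sin (((k:ℝ) + 2) * θ) := by
    rw [Finset.sum_range_succ]
    have hend : Real.sin ((((n + 1 : ℕ):ℝ) + 2) * θ) = 0 := by
      have := sin_chain_end n; push_cast; rw [hθ]
      rw [show ((n:ℝ) + 1 + 2) = (n:ℝ) + 3 by ring]; exact this
    rw [hend, zero_mul, add_zero]
    exact Finset.sum_congr rfl fun k _ => by ring
  -- second sum: the first term vanishes (`sin 0 = 0`), then shift the index
  have hB : ∑ k ∈ Finset.range (n + 2), Real.sin ((k:ℝ) * θ) * Real.sin (((k:ℝ) + 1) * θ)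
      = ∑ k ∈ Finset.range (n + 1), Real.sin (((k:ℝ) + 1) * θ) * Real.sin (((k:ℝ) + 2) * θ) := by
    rw [Finset.sum_range_succ']
    simp only [Nat.cast_zero, zero_mul, Real.sin_zero, add_zero, Nat.cast_add, Nat.cast_one]
    exact Finset.sum_congr rfl fun k _ => by ring_nf
  rw [hA, hB]
  ring

/-- PROVED: the sine vector is nonzero — its first entry `sin(π/(n+3))` is positive, so its square sum over
`k ≤ n+1` is positive. [folklore] -/
theorem sine_vector_sq_sum_pos (n : ℕ) :
    0 < ∑ k ∈ Finset.range (n + 2), Real.sin (((k:ℝ) + 1) * (π / ((n:ℝ) + 3))) ^ 2 := by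
  have h0 : 0 < Real.sin ((((0:ℕ):ℝ) + 1) * (π / ((n:ℝ) + 3))) ^ 2 := by
    have := sin_chain_pos (n := n) (k := 0) (Nat.zero_le _)
    positivity
  have hmem : (0:ℕ) ∈ Finset.range (n + 2) := Finset.mem_range.mpr (by omega)
  have hle := Finset.single_le_sum (f := fun k : ℕ => Real.sin (((k:ℝ) + 1) * (π / ((n:ℝ) + 3))) ^ 2)
    (fun k _ => sq_nonneg _) hmem
  exact lt_of_lt_of_le h0 hle

/-- **PROVED — THE LADDER CONSTANT IS THE MAXIMUM:** `2cos(π/(n+3))` is attained by the path-graph Rayleigh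
quotient at a nonzero vector; hence it is the best constant in `two_mul_sum_mul_succ_le_cos`, and no re-weighting
of the `(n+2)`-piece chain lowers the near-lag ceiling `c_{n+2} = cos(π/(n+3))`. [cite: Mieghem2010, §6.4.1 eq. (6.10)] -/
theorem exists_rayleigh_eq_cos (n : ℕ) :
    ∃ x : ℕ → ℝ, 0 < ∑ k ∈ Finset.range (n + 2), x k ^ 2 ∧
      2 * ∑ k ∈ Finset.range (n + 1), x k * x (k + 1)
        = 2 * Real.cos (π / ((n:ℝ) + 3)) * ∑ k ∈ Finset.range (n + 2), x k ^ 2 := by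
  refine ⟨fun k => Real.sin (((k:ℝ) + 1) * (π / ((n:ℝ) + 3))), sine_vector_sq_sum_pos n, ?_⟩
  have h := chain_tight n
  simp only [Nat.cast_add, Nat.cast_one]
  convert h using 4 with k
  ring_nf

/-- **PROVED — rung-indexed form** (`m = n + 2 ≥ 2`; for `m = 1` the ceiling `cos(π/2) = 0` is attained
trivially by the one-piece chain): for every `m ≥ 2` the constant `2cos(π/(m+1))` is attained by the path-graph
Rayleigh quotient on `m` entries. [cite: Mieghem2010, §6.4.1 eq. (6.10)] -/
theorem exists_rayleigh_eq_cos_rung {m : ℕ} (hm : 2 ≤ m) :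
    ∃ x : ℕ → ℝ, 0 < ∑ k ∈ Finset.range m, x k ^ 2 ∧
      2 * ∑ k ∈ Finset.range (m - 1), x k * x (k + 1)
        = 2 * Real.cos (π / ((m:ℝ) + 1)) * ∑ k ∈ Finset.range m, x k ^ 2 := by
  obtain ⟨n, rfl⟩ : ∃ n, m = n + 2 := ⟨m - 2, by omega⟩
  have e1 : n + 2 - 1 = n + 1 := by omega
  have e2 : (((n + 2 : ℕ):ℝ) + 1) = (n:ℝ) + 3 := by push_cast; ring
  rw [e1, e2]
  exact exists_rayleigh_eq_cos n

end Summit.RiemannHypothesis.RiemannHypothesis.Theorems.PfPersistence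

end
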